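import Literature.NumberTheory.Automorphic.UnitaryGroupCohomologicalForms
import Literature.NumberTheory.Automorphic.UnitaryGroupAdelicProductHaar
import Summits.HodgeConjecture.HodgeConjecture.Theorems.F0P2aCmFrameFactorisation
import Literature.NumberTheory.Automorphic.AutomorphicFormsL2OrbitalSmoothingU21
import Literature.NumberTheory.Automorphic.AutomorphicFormsL2InvariantAverage
import HarnessLib

/-!
# Crux `H413`, (D) sub-line `F0_P2SpectralProjectionD` — stub (R), ENGINE HALF: exactly `K_c K_f`-invariant representatives, «every orbit
# function is locally integrable», continuity of orbital integrals on `U(H)(𝔸)` (road (h) steps h3′/h4)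

Cell hodgecm-mathlib, FLOOR 0, crux item H413 = stmt-HodgeConjecture-24833; P2 sub-line `Cruxes/H413/Lines/F0_P2SpectralProjectionD.lean` v1.2,
registered stub **(R) `stub_R_regularOfReproduced`** (F0P2-p04 (g2)).  THEOREMS ONLY; `--supports stmt-HodgeConjecture-24833 --as helper`.
HC_CM is proved only modulo the 7 printed citations until rung 0 closes.  Companion (the closer): `Theorems/F0P2dStubR.lean :: stubR_holds`.

SETTING: `L` CM, `H ∈ M₃(L)`, frame `T` of signature `(2,1)` at `ι`; `(adelicGroupData (↥(maximalRealSubfield L)) L (IsCMField.complexConj L) 3 H) = adelicGroupData L⁺ L c̄ 3 H`, `ιinf = cmArchSection`, `K_c = cmCompactFactor`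
(compact when `H` is definite at the places `≠ ι`), `(1, ·) = finAdelicToAdelic`.
* §0 (★ facts re-threaded): `K_c ≤ awayFromCM`, so `K_c` and `(1, U(H)(𝔸_f))` commute with `ιinf(U(2,1))` and with each other; the DECOMPOSITION
  `x = ιinf(U x) · k(x) · (1, x_f)`, `U x = archProjU21EmbCM (x_∞)` continuous, `k(x) ∈ K_c` (★ `F0P2aCmFrameFactorisation`).
* §1 `exists_invariant_representative`: an `L²` class fixed by `K_c` and by a compact open `K_f` has a strongly measurable representative invariant
  under `K_c` and `(1, K_f)` AT EVERY POINT (average over `K_c`, then `K_f`; ★ `AutomorphicFormsL2InvariantAverage`).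
* §2 `locallyIntegrable_orbitFun_of_invariant(')`: for such a representative (with `K_f` OPEN) EVERY orbit function `u ↦ F(ιinf(u)⁻¹ • ξ)` is locally
  integrable — the bad set is `μ`-null (★ `ae_locallyIntegrable_orbitFun`) and OPEN (its preimage in `U(H)(𝔸)` is stable under left multiplication
  by `ιinf(U(2,1)) · K_c · (1, K_f) ⊇ {z | z_f ∈ K_f}`), hence EMPTY (`μ` charges opens) — no saturation∕modification needed; and orbital integrals
  `x ↦ ∫ β(u) φ(x ιinf u) dν` (`β ∈ C_c(U(2,1))`) are CONTINUOUS ON `U(H)(𝔸)` (`continuous_orbitalIntegral_of_invariant`: near `x₀` they equal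
  `Θ(x₀ ιinf(U(x₀⁻¹x)))` by the decomposition and exact right invariances; ★ `continuous_orbitalIntegral_mul_hom` along the orbit).

## References
* [BorelJacquet1979] A. Borel, H. Jacquet, Corvallis PSPM 33.1 (1979), §4.1–4.2, §4.6.  [Borel1997] A. Borel, *Automorphic forms on SL₂(ℝ)*
  (1997), Thm. 2.13–2.14, §8.4.  [Folland1995] G. B. Folland (1995), §2.2, §3.2.  [HarishChandra1966] Acta Math. 116 (1966), §8.
-/

set_option autoImplicit false
-- the mandated namespace has the single-problem summit's repeated segment (`HodgeConjecture.HodgeConjecture`)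
set_option linter.dupNamespace false

noncomputable section

namespace Summit.HodgeConjecture.HodgeConjecture.Cruxes.H413.F0P2dStubR

open scoped Topology ENNReal Pointwise Matrix ComplexOrder
open MeasureTheory NumberField Set Filter Function
open Literature.NumberTheory.Automorphic Literature.NumberTheory.Automorphic.UnitaryGroup
open Literature.NumberTheory.Automorphic.UnitaryGroup.CotangentForms
open Literature.NumberTheory.Automorphic.OrbitalSmoothingU21
open Literature.AlgebraicGeometry.ShimuraVarieties
open Literature.Geometry.ComplexHyperbolic.BallModel (U21)

/-! ## §0 The engine datum: commuting factors and the decomposition `x = ιinf(U x) · k(x) · ι_f(x_f)` (★ `F0P2aCmFrameFactorisation`, re-threaded) -/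

section Engine

variable (L : Type) [Field L] [NumberField L] [IsCMField L] (ι : L →+* ℂ) (H : Matrix (Fin 3) (Fin 3) L)
  (T : GL (Fin 3) ℂ)
  (hT : (T : Matrix (Fin 3) (Fin 3) ℂ)ᴴ * H.map ι * (T : Matrix (Fin 3) (Fin 3) ℂ) = Literature.Geometry.ComplexHyperbolic.BallModel.J)

/-- `K_c` commutes with the archimedean section: `k · ιinf(u) = ιinf(u) · k` (★ `F0P2aCmFrameFactorisation.cmArchSection_mul_of_mem_cmCompactFactor`).
[cite: BorelJacquet1979, §4.1] -/
theorem commute_cmArchSection_of_mem_cmCompactFactor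
    {k : (adelicGroupData (↥(maximalRealSubfield L)) L (IsCMField.complexConj L) 3 H).Adelic} (hk : k ∈ cmCompactFactor L ι H T hT) (u : U21) :
    Commute k (cmArchSection L ι H T hT u) :=
  (F0P2aCmFrameFactorisation.cmArchSection_mul_of_mem_cmCompactFactor L ι H T hT u hk).symm

/-- The finite-adelic factor commutes with the archimedean section (★ `F0P2aCmFrameFactorisation.cmArchSection_mul_finAdelicToAdelic`).
[cite: BorelJacquet1979, §4.1] -/
theorem commute_finAdelicToAdelic_cmArchSection (g : finAdelic (↥(maximalRealSubfield L)) L (IsCMField.complexConj L) 3 H) (u : U21) :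
    Commute ((finAdelicToAdelic (↥(maximalRealSubfield L)) L (IsCMField.complexConj L) 3 H) g) (cmArchSection L ι H T hT u) :=
  (F0P2aCmFrameFactorisation.cmArchSection_mul_finAdelicToAdelic L ι H T hT u g).symm

/-- `K_c` commutes with the finite-adelic factor (★ `F0P2aCmFrameFactorisation.mul_finAdelicToAdelic_of_mem_cmCompactFactor`). [cite: BorelJacquet1979, §4.1] -/
theorem commute_finAdelicToAdelic_of_mem_cmCompactFactor
    {k : (adelicGroupData (↥(maximalRealSubfield L)) L (IsCMField.complexConj L) 3 H).Adelic} (hk : k ∈ cmCompactFactor L ι H T hT)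
    (g : finAdelic (↥(maximalRealSubfield L)) L (IsCMField.complexConj L) 3 H) :
    Commute k ((finAdelicToAdelic (↥(maximalRealSubfield L)) L (IsCMField.complexConj L) 3 H) g) :=
  F0P2aCmFrameFactorisation.mul_finAdelicToAdelic_of_mem_cmCompactFactor L ι H T hT hk g

/-- **The `U(2,1)`-coordinate of an adelic point**, `U x := archProjU21EmbCM ((x)_∞)`, is continuous. [cite: BorelJacquet1979, §4.1] -/
theorem continuous_archProjU21EmbCM_archPart :
    Continuous fun x : (adelicGroupData (↥(maximalRealSubfield L)) L (IsCMField.complexConj L) 3 H).Adelic ↦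
      archProjU21EmbCM L H ι T (formCongr_eq_of_conjTranspose L ι H T hT)
        (archPart (↥(maximalRealSubfield L)) L (IsCMField.complexConj L) 3 H x) :=
  (continuous_archProjU21EmbCM L H ι T _).comp (continuous_archPart _ _ _ _ _)

end Engine

/-! ## §1 Exactly `K_c K_f`-invariant representatives by compact averaging -/

section Average

variable (L : Type) [Field L] [NumberField L] [IsCMField L] (ι : L →+* ℂ) (H : Matrix (Fin 3) (Fin 3) L)
  (T : GL (Fin 3) ℂ)
  (hT : (T : Matrix (Fin 3) (Fin 3) ℂ)ᴴ * H.map ι * (T : Matrix (Fin 3) (Fin 3) ℂ) = Literature.Geometry.ComplexHyperbolic.BallModel.J)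

/-- **A normalised left Haar measure on a compact group** (probability, left-invariant). [cite: Folland1995, §2.2] -/
theorem exists_isProbabilityMeasure_isMulLeftInvariant (S : Type) [Group S] [TopologicalSpace S] [IsTopologicalGroup S]
    [CompactSpace S] [MeasurableSpace S] [BorelSpace S] :
    ∃ ρ : Measure S, IsProbabilityMeasure ρ ∧ ρ.IsMulLeftInvariant := by
  set η : Measure S := Measure.haar with hη
  have h0 : η univ ≠ 0 := IsOpen.measure_ne_zero η isOpen_univ univ_nonempty
  have htop : η univ ≠ ∞ := measure_ne_top η _
  refine ⟨(η univ)⁻¹ • η, ⟨?_⟩, inferInstance⟩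
  rw [Measure.smul_apply, smul_eq_mul, ENNReal.inv_mul_cancel h0 htop]

/-- **EXACTLY `K_c K_f`-INVARIANT REPRESENTATIVES.**  In the engine setting (`H` definite at the places `≠ ι`, so that `K_c` is
compact), an `L²` class `v` on the automorphic quotient fixed by the compact archimedean factor `K_c = cmCompactFactor` and by a compact
open `K_f ≤ U(H)(𝔸_{L⁺,f})` has a strongly measurable square-integrable representative `F` that is invariant under `K_c` and `K_f` AT
EVERY POINT: average the `L²` representative over `K_c`, then over `K_f` (Haar probability measures; ★ `average_ae_eq_of_forall_rightRegular_eq`,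
`average_smul_eq`, `average_smul_eq_of_commute` — `K_c` and `(1, K_f)` commute). [cite: Folland1995, §2.2 and §3.2] [cite: BorelJacquet1979, §4.1] -/
theorem exists_invariant_representative (hdef : ∀ τ' : L →+* ℂ, InfinitePlace.mk τ' ≠ InfinitePlace.mk ι → (H.map τ').PosDef)
    (μ : Measure (adelicGroupData (↥(maximalRealSubfield L)) L (IsCMField.complexConj L) 3 H).automorphicQuotient) [(adelicGroupData (↥(maximalRealSubfield L)) L (IsCMField.complexConj L) 3 H).IsAutomorphicMeasure μ]
    (Kf : Subgroup (finAdelic (↥(maximalRealSubfield L)) L (IsCMField.complexConj L) 3 H))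
    (hKfc : IsCompact (Kf : Set (finAdelic (↥(maximalRealSubfield L)) L (IsCMField.complexConj L) 3 H)))
    (v : (adelicGroupData (↥(maximalRealSubfield L)) L (IsCMField.complexConj L) 3 H).L2 μ) (hkc : ∀ k ∈ cmCompactFactor L ι H T hT, (adelicGroupData (↥(maximalRealSubfield L)) L (IsCMField.complexConj L) 3 H).rightRegular μ k v = v)
    (hkf : ∀ k ∈ Kf, (adelicGroupData (↥(maximalRealSubfield L)) L (IsCMField.complexConj L) 3 H).rightRegular μ ((finAdelicToAdelic (↥(maximalRealSubfield L)) L (IsCMField.complexConj L) 3 H) k) v = v) :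
    ∃ F : (adelicGroupData (↥(maximalRealSubfield L)) L (IsCMField.complexConj L) 3 H).automorphicQuotient → ℂ, StronglyMeasurable F ∧ (∃ hF : MemLp F 2 μ, hF.toLp F = v) ∧
      (∀ k ∈ cmCompactFactor L ι H T hT, ∀ ξ, F (k • ξ) = F ξ) ∧ (∀ k ∈ Kf, ∀ ξ, F ((finAdelicToAdelic (↥(maximalRealSubfield L)) L (IsCMField.complexConj L) 3 H) k • ξ) = F ξ) := by
  haveI : SecondCountableTopology (adelicGroupData (↥(maximalRealSubfield L)) L (IsCMField.complexConj L) 3 H).Adelic :=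
    inferInstanceAs (SecondCountableTopology (adelic (↥(maximalRealSubfield L)) L (IsCMField.complexConj L) 3 H))
  haveI : SecondCountableTopology (finAdelic (↥(maximalRealSubfield L)) L (IsCMField.complexConj L) 3 H) :=
    (isClosedEmbedding_finAdelicToAdelic (↥(maximalRealSubfield L)) L (IsCMField.complexConj L) 3 H).isEmbedding.secondCountableTopology
  set F₀ : (adelicGroupData (↥(maximalRealSubfield L)) L (IsCMField.complexConj L) 3 H).automorphicQuotient → ℂ := (v : (adelicGroupData (↥(maximalRealSubfield L)) L (IsCMField.complexConj L) 3 H).automorphicQuotient → ℂ) with hF₀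
  have hF₀m : StronglyMeasurable F₀ := Lp.stronglyMeasurable v
  have hF₀mem : MemLp F₀ 2 μ := Lp.memLp v
  have hF₀toLp : hF₀mem.toLp F₀ = v := Lp.ext (MemLp.coeFn_toLp _)
  set Kc := cmCompactFactor L ι H T hT with hKc
  haveI : CompactSpace Kc := isCompact_iff_compactSpace.mp (isCompact_cmCompactFactor L ι H T hT hdef)
  haveI : SecondCountableTopology Kc := Topology.IsEmbedding.subtypeVal.secondCountableTopology
  letI : MeasurableSpace Kc := borel Kc
  haveI : BorelSpace Kc := ⟨rfl⟩
  obtain ⟨ρ₁, hρ₁p, hρ₁i⟩ := exists_isProbabilityMeasure_isMulLeftInvariant Kc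
  haveI := hρ₁p
  haveI := hρ₁i
  have hc₁ : Continuous (Kc.subtype : Kc →* (adelicGroupData (↥(maximalRealSubfield L)) L (IsCMField.complexConj L) 3 H).Adelic) := continuous_subtype_val
  set F₁ : (adelicGroupData (↥(maximalRealSubfield L)) L (IsCMField.complexConj L) 3 H).automorphicQuotient → ℂ := fun ξ ↦ ∫ s, F₀ ((Kc.subtype s)⁻¹ • ξ) ∂ρ₁ with hF₁
  have hF₁ae : F₁ =ᵐ[μ] F₀ :=
    (adelicGroupData (↥(maximalRealSubfield L)) L (IsCMField.complexConj L) 3 H).average_ae_eq_of_forall_rightRegular_eq μ ρ₁ hc₁ hF₀mem fun s ↦ by rw [hF₀toLp]; exact hkc s s.2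
  have hF₁m : StronglyMeasurable F₁ := (adelicGroupData (↥(maximalRealSubfield L)) L (IsCMField.complexConj L) 3 H).stronglyMeasurable_average ρ₁ hc₁ hF₀m
  have hF₁mem : MemLp F₁ 2 μ := hF₀mem.ae_eq hF₁ae.symm
  have hF₁toLp : hF₁mem.toLp F₁ = v := Lp.ext ((MemLp.coeFn_toLp _).trans hF₁ae)
  have hF₁c : ∀ k ∈ Kc, ∀ ξ, F₁ (k • ξ) = F₁ ξ := fun k hk ξ ↦
    (adelicGroupData (↥(maximalRealSubfield L)) L (IsCMField.complexConj L) 3 H).average_smul_eq ρ₁ F₀ (⟨k, hk⟩ : Kc) ξ (c := Kc.subtype)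
  haveI : CompactSpace Kf := isCompact_iff_compactSpace.mp hKfc
  haveI : SecondCountableTopology Kf := Topology.IsEmbedding.subtypeVal.secondCountableTopology
  letI : MeasurableSpace Kf := borel Kf
  haveI : BorelSpace Kf := ⟨rfl⟩
  obtain ⟨ρ₂, hρ₂p, hρ₂i⟩ := exists_isProbabilityMeasure_isMulLeftInvariant Kf
  haveI := hρ₂p
  haveI := hρ₂i
  set c₂ : Kf →* (adelicGroupData (↥(maximalRealSubfield L)) L (IsCMField.complexConj L) 3 H).Adelic := (finAdelicToAdelic (↥(maximalRealSubfield L)) L (IsCMField.complexConj L) 3 H).comp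
    Kf.subtype with hc₂def
  have hc₂ : Continuous c₂ :=
    (continuous_finAdelicToAdelic (↥(maximalRealSubfield L)) L (IsCMField.complexConj L) 3 H).comp continuous_subtype_val
  set F₂ : (adelicGroupData (↥(maximalRealSubfield L)) L (IsCMField.complexConj L) 3 H).automorphicQuotient → ℂ := fun ξ ↦ ∫ t, F₁ ((c₂ t)⁻¹ • ξ) ∂ρ₂ with hF₂
  have hF₂ae : F₂ =ᵐ[μ] F₁ :=
    (adelicGroupData (↥(maximalRealSubfield L)) L (IsCMField.complexConj L) 3 H).average_ae_eq_of_forall_rightRegular_eq μ ρ₂ hc₂ hF₁mem fun t ↦ by rw [hF₁toLp]; exact hkf t t.2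
  have hF₂m : StronglyMeasurable F₂ := (adelicGroupData (↥(maximalRealSubfield L)) L (IsCMField.complexConj L) 3 H).stronglyMeasurable_average ρ₂ hc₂ hF₁m
  have hF₂mem : MemLp F₂ 2 μ := hF₁mem.ae_eq hF₂ae.symm
  have hF₂toLp : hF₂mem.toLp F₂ = v := Lp.ext ((MemLp.coeFn_toLp _).trans (hF₂ae.trans ((MemLp.coeFn_toLp _).symm.trans
    (Lp.ext_iff.1 hF₁toLp))))
  have hF₂f : ∀ k ∈ Kf, ∀ ξ, F₂ ((finAdelicToAdelic (↥(maximalRealSubfield L)) L (IsCMField.complexConj L) 3 H) k • ξ) = F₂ ξ := fun k hk ξ ↦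
    (adelicGroupData (↥(maximalRealSubfield L)) L (IsCMField.complexConj L) 3 H).average_smul_eq ρ₂ F₁ (⟨k, hk⟩ : Kf) ξ (c := c₂)
  have hF₂c : ∀ k ∈ Kc, ∀ ξ, F₂ (k • ξ) = F₂ ξ := fun k hk ξ ↦
    (adelicGroupData (↥(maximalRealSubfield L)) L (IsCMField.complexConj L) 3 H).average_smul_eq_of_commute F₁ (hF₁c k hk) (c := c₂) (fun t : Kf ↦
      commute_finAdelicToAdelic_of_mem_cmCompactFactor L ι H T hT hk t.1) ξ
  exact ⟨F₂, hF₂m, ⟨hF₂mem, hF₂toLp⟩, hF₂c, hF₂f⟩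

end Average

/-! ## §2 Exactly invariant functions: every orbit function is locally integrable; orbital integrals are continuous on `G(𝔸)` -/

section Good

variable (L : Type) [Field L] [NumberField L] [IsCMField L] (ι : L →+* ℂ) (H : Matrix (Fin 3) (Fin 3) L)
  (T : GL (Fin 3) ℂ)
  (hT : (T : Matrix (Fin 3) (Fin 3) ℂ)ᴴ * H.map ι * (T : Matrix (Fin 3) (Fin 3) ℂ) = Literature.Geometry.ComplexHyperbolic.BallModel.J)

/-- For an exactly `K_c`-invariant function the orbit functions of `k • ξ` and `ξ` COINCIDE (`K_c` commutes with `ιinf`).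
[cite: BorelJacquet1979, §4.1] -/
theorem orbitFun_smul_of_mem_cmCompactFactor (F : (adelicGroupData (↥(maximalRealSubfield L)) L (IsCMField.complexConj L) 3 H).automorphicQuotient → ℂ)
    (hinvc : ∀ k ∈ cmCompactFactor L ι H T hT, ∀ ξ, F (k • ξ) = F ξ) {k : (adelicGroupData (↥(maximalRealSubfield L)) L (IsCMField.complexConj L) 3 H).Adelic} (hk : k ∈ cmCompactFactor L ι H T hT)
    (ξ : (adelicGroupData (↥(maximalRealSubfield L)) L (IsCMField.complexConj L) 3 H).automorphicQuotient) :
    (fun u : U21 ↦ F ((cmArchSection L ι H T hT u)⁻¹ • (k • ξ))) = fun u ↦ F ((cmArchSection L ι H T hT u)⁻¹ • ξ) := by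
  funext u
  rw [← mul_smul, ← ((commute_cmArchSection_of_mem_cmCompactFactor L ι H T hT hk u).inv_right).eq, mul_smul, hinvc k hk]

/-- For an exactly `K_f`-invariant function the orbit functions of `(1,k) • ξ` and `ξ` COINCIDE. [cite: BorelJacquet1979, §4.1] -/
theorem orbitFun_smul_of_mem_finite (F : (adelicGroupData (↥(maximalRealSubfield L)) L (IsCMField.complexConj L) 3 H).automorphicQuotient → ℂ)
    {Kf : Subgroup (finAdelic (↥(maximalRealSubfield L)) L (IsCMField.complexConj L) 3 H)}
    (hinvf : ∀ k ∈ Kf, ∀ ξ, F ((finAdelicToAdelic (↥(maximalRealSubfield L)) L (IsCMField.complexConj L) 3 H) k • ξ) = F ξ) {k : finAdelic (↥(maximalRealSubfield L)) L (IsCMField.complexConj L) 3 H}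
    (hk : k ∈ Kf) (ξ : (adelicGroupData (↥(maximalRealSubfield L)) L (IsCMField.complexConj L) 3 H).automorphicQuotient) :
    (fun u : U21 ↦ F ((cmArchSection L ι H T hT u)⁻¹ • ((finAdelicToAdelic (↥(maximalRealSubfield L)) L (IsCMField.complexConj L) 3 H) k • ξ))) = fun u ↦ F ((cmArchSection L ι H T hT u)⁻¹ • ξ) := by
  funext u
  rw [← mul_smul, ← ((commute_finAdelicToAdelic_cmArchSection L ι H T hT k u).inv_right).eq, mul_smul, hinvf k hk]

/-- **Every orbit function of an exactly `K_c K_f`-invariant `L¹` function is locally integrable** (`K_f` OPEN).  The set of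
bad points is `μ`-null (★ `ae_locallyIntegrable_orbitFun`), and its preimage in `U(H)(𝔸)` is open: it is stable under left
multiplication by `ιinf(U(2,1)) · K_c · (1, K_f)`, which contains the neighbourhood `{z | z_f ∈ K_f}` of `1`
(`exists_decomposition`); so the bad set is an open null set of the quotient, hence EMPTY (`μ` charges non-empty open sets).
[cite: BorelJacquet1979, §4.1–4.2] [cite: Borel1997, §8.4] -/
theorem locallyIntegrable_orbitFun_of_invariant (μ : Measure (adelicGroupData (↥(maximalRealSubfield L)) L (IsCMField.complexConj L) 3 H).automorphicQuotient) [(adelicGroupData (↥(maximalRealSubfield L)) L (IsCMField.complexConj L) 3 H).IsAutomorphicMeasure μ]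
    (ν : Measure U21) [ν.IsHaarMeasure]
    {Kf : Subgroup (finAdelic (↥(maximalRealSubfield L)) L (IsCMField.complexConj L) 3 H)}
    (hKfo : IsOpen (Kf : Set (finAdelic (↥(maximalRealSubfield L)) L (IsCMField.complexConj L) 3 H)))
    {F : (adelicGroupData (↥(maximalRealSubfield L)) L (IsCMField.complexConj L) 3 H).automorphicQuotient → ℂ} (hFm : StronglyMeasurable F) (hFi : Integrable F μ)
    (hinvc : ∀ k ∈ cmCompactFactor L ι H T hT, ∀ ξ, F (k • ξ) = F ξ) (hinvf : ∀ k ∈ Kf, ∀ ξ, F ((finAdelicToAdelic (↥(maximalRealSubfield L)) L (IsCMField.complexConj L) 3 H) k • ξ) = F ξ)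
    (ξ : (adelicGroupData (↥(maximalRealSubfield L)) L (IsCMField.complexConj L) 3 H).automorphicQuotient) :
    LocallyIntegrable (fun u : U21 ↦ F ((cmArchSection L ι H T hT u)⁻¹ • ξ)) ν := by
  haveI : SecondCountableTopology (adelicGroupData (↥(maximalRealSubfield L)) L (IsCMField.complexConj L) 3 H).Adelic :=
    inferInstanceAs (SecondCountableTopology (adelic (↥(maximalRealSubfield L)) L (IsCMField.complexConj L) 3 H))
  have hι : Continuous (cmArchSection L ι H T hT) := continuous_archSectionU21CM L ι H T hT
  -- the good predicate and its invariances
  set Gd : (adelicGroupData (↥(maximalRealSubfield L)) L (IsCMField.complexConj L) 3 H).automorphicQuotient → Prop := fun ξ ↦ LocallyIntegrable (fun u : U21 ↦ F ((cmArchSection L ι H T hT u)⁻¹ • ξ)) ν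
    with hGd
  have h_arch : ∀ (g : U21) (η : (adelicGroupData (↥(maximalRealSubfield L)) L (IsCMField.complexConj L) 3 H).automorphicQuotient), Gd (cmArchSection L ι H T hT g • η) ↔ Gd η := fun g η ↦
    (adelicGroupData (↥(maximalRealSubfield L)) L (IsCMField.complexConj L) 3 H).locallyIntegrable_orbitFun_smul_iff ν F η g
  have h_c : ∀ k ∈ cmCompactFactor L ι H T hT, ∀ η, Gd (k • η) ↔ Gd η := fun k hk η ↦ by
    simp only [hGd, orbitFun_smul_of_mem_cmCompactFactor L ι H T hT F hinvc hk]
  have h_f : ∀ k ∈ Kf, ∀ η, Gd ((finAdelicToAdelic (↥(maximalRealSubfield L)) L (IsCMField.complexConj L) 3 H) k • η) ↔ Gd η := fun k hk η ↦ by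
    simp only [hGd, orbitFun_smul_of_mem_finite L ι H T hT F hinvf hk]
  -- the preimage of the bad set in the group is open
  have hP : IsOpen {y : (adelicGroupData (↥(maximalRealSubfield L)) L (IsCMField.complexConj L) 3 H).Adelic | ¬ Gd ((adelicGroupData (↥(maximalRealSubfield L)) L (IsCMField.complexConj L) 3 H).toAutomorphicQuotient y)} := by
    rw [isOpen_iff_mem_nhds]
    intro y₀ hy₀
    have hV : {y : (adelicGroupData (↥(maximalRealSubfield L)) L (IsCMField.complexConj L) 3 H).Adelic | finPart (↥(maximalRealSubfield L)) L (IsCMField.complexConj L) 3 H (y * y₀⁻¹) ∈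
        (Kf : Set (finAdelic (↥(maximalRealSubfield L)) L (IsCMField.complexConj L) 3 H))} ∈ 𝓝 y₀ := by
      refine (hKfo.preimage ((continuous_finPart _ _ _ _ _).comp (continuous_id.mul continuous_const))).mem_nhds ?_
      show finPart (↥(maximalRealSubfield L)) L (IsCMField.complexConj L) 3 H (y₀ * y₀⁻¹) ∈ Kf
      rw [mul_inv_cancel, map_one]
      exact Kf.one_mem
    filter_upwards [hV] with y hy
    obtain ⟨k, hk, hdec⟩ := F0P2aCmFrameFactorisation.exists_eq_cmArchSection_mul_cmCompactFactor_mul_finAdelicToAdelic L ι H T hT (y * y₀⁻¹)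
    intro hgood
    apply hy₀
    have hy' : (adelicGroupData (↥(maximalRealSubfield L)) L (IsCMField.complexConj L) 3 H).toAutomorphicQuotient y = (y * y₀⁻¹) • (adelicGroupData (↥(maximalRealSubfield L)) L (IsCMField.complexConj L) 3 H).toAutomorphicQuotient y₀ := by
      show (QuotientGroup.mk y : (adelicGroupData (↥(maximalRealSubfield L)) L (IsCMField.complexConj L) 3 H).Adelic ⧸ (adelicGroupData (↥(maximalRealSubfield L)) L (IsCMField.complexConj L) 3 H).quotientSubgroup) = (y * y₀⁻¹) • (QuotientGroup.mk y₀ : (adelicGroupData (↥(maximalRealSubfield L)) L (IsCMField.complexConj L) 3 H).Adelic ⧸ (adelicGroupData (↥(maximalRealSubfield L)) L (IsCMField.complexConj L) 3 H).quotientSubgroup)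
      rw [MulAction.Quotient.smul_mk, smul_eq_mul, inv_mul_cancel_right]
    have h1 : Gd ((y * y₀⁻¹) • (adelicGroupData (↥(maximalRealSubfield L)) L (IsCMField.complexConj L) 3 H).toAutomorphicQuotient y₀) := hy' ▸ hgood
    rw [hdec, mul_smul, mul_smul, h_arch, h_c k hk, h_f _ hy] at h1
    exact h1
  -- the bad set is the (open) image of its preimage, and is null
  have hBad : {ξ : (adelicGroupData (↥(maximalRealSubfield L)) L (IsCMField.complexConj L) 3 H).automorphicQuotient | ¬ Gd ξ} = (adelicGroupData (↥(maximalRealSubfield L)) L (IsCMField.complexConj L) 3 H).toAutomorphicQuotient '' {y | ¬ Gd ((adelicGroupData (↥(maximalRealSubfield L)) L (IsCMField.complexConj L) 3 H).toAutomorphicQuotient y)} := by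
    ext η
    constructor
    · intro h
      obtain ⟨y, rfl⟩ := QuotientGroup.mk_surjective η
      exact ⟨y, h, rfl⟩
    · rintro ⟨y, hy, rfl⟩
      exact hy
  have hopen : IsOpen {ξ : (adelicGroupData (↥(maximalRealSubfield L)) L (IsCMField.complexConj L) 3 H).automorphicQuotient | ¬ Gd ξ} := by
    rw [hBad]
    exact QuotientGroup.isOpenMap_coe _ hP
  have hnull : μ {ξ : (adelicGroupData (↥(maximalRealSubfield L)) L (IsCMField.complexConj L) 3 H).automorphicQuotient | ¬ Gd ξ} = 0 :=
    ae_iff.1 ((adelicGroupData (↥(maximalRealSubfield L)) L (IsCMField.complexConj L) 3 H).ae_locallyIntegrable_orbitFun μ ν hι hFm hFi)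
  have hempty : {ξ : (adelicGroupData (↥(maximalRealSubfield L)) L (IsCMField.complexConj L) 3 H).automorphicQuotient | ¬ Gd ξ} = ∅ := (hopen.measure_eq_zero_iff μ).1 hnull
  by_contra h
  have : ξ ∈ ({ξ : (adelicGroupData (↥(maximalRealSubfield L)) L (IsCMField.complexConj L) 3 H).automorphicQuotient | ¬ Gd ξ} : Set _) := h
  rw [hempty] at this
  exact this

/-- Group form: every base point of `U(H)(𝔸)` is good. [cite: BorelJacquet1979, §4.1–4.2] -/
theorem locallyIntegrable_orbitFun_of_invariant' (μ : Measure (adelicGroupData (↥(maximalRealSubfield L)) L (IsCMField.complexConj L) 3 H).automorphicQuotient) [(adelicGroupData (↥(maximalRealSubfield L)) L (IsCMField.complexConj L) 3 H).IsAutomorphicMeasure μ]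
    (ν : Measure U21) [ν.IsHaarMeasure]
    {Kf : Subgroup (finAdelic (↥(maximalRealSubfield L)) L (IsCMField.complexConj L) 3 H)}
    (hKfo : IsOpen (Kf : Set (finAdelic (↥(maximalRealSubfield L)) L (IsCMField.complexConj L) 3 H)))
    {F : (adelicGroupData (↥(maximalRealSubfield L)) L (IsCMField.complexConj L) 3 H).automorphicQuotient → ℂ} (hFm : StronglyMeasurable F) (hFi : Integrable F μ)
    (hinvc : ∀ k ∈ cmCompactFactor L ι H T hT, ∀ ξ, F (k • ξ) = F ξ) (hinvf : ∀ k ∈ Kf, ∀ ξ, F ((finAdelicToAdelic (↥(maximalRealSubfield L)) L (IsCMField.complexConj L) 3 H) k • ξ) = F ξ)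
    (x : (adelicGroupData (↥(maximalRealSubfield L)) L (IsCMField.complexConj L) 3 H).Adelic) :
    LocallyIntegrable (fun u : U21 ↦ invQuot (adelicGroupData (↥(maximalRealSubfield L)) L (IsCMField.complexConj L) 3 H) F (x * cmArchSection L ι H T hT u)) ν := by
  have h := locallyIntegrable_orbitFun_of_invariant L ι H T hT μ ν hKfo hFm hFi hinvc hinvf ((adelicGroupData (↥(maximalRealSubfield L)) L (IsCMField.complexConj L) 3 H).toAutomorphicQuotient x⁻¹)
  have e := (adelicGroupData (↥(maximalRealSubfield L)) L (IsCMField.complexConj L) 3 H).orbitFun_inv_apply F x⁻¹ (ι := cmArchSection L ι H T hT)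
  rw [inv_inv] at e
  rw [e]
  exact h

/-- **Right invariances of orbital integrals of an exactly invariant function**: `Θ(x k) = Θ(x)` for `k ∈ K_c` and for `k ∈ (1, K_f)`,
where `Θ(x) = ∫ β(u) φ(x ιinf(u)) dν(u)`, `φ = invQuot F`. [cite: BorelJacquet1979, §4.1] -/
theorem orbitalIntegral_mul_of_mem_cmCompactFactor (ν : Measure U21) (β : U21 → ℂ) (F : (adelicGroupData (↥(maximalRealSubfield L)) L (IsCMField.complexConj L) 3 H).automorphicQuotient → ℂ)
    (hinvc : ∀ k ∈ cmCompactFactor L ι H T hT, ∀ ξ, F (k • ξ) = F ξ) {k : (adelicGroupData (↥(maximalRealSubfield L)) L (IsCMField.complexConj L) 3 H).Adelic} (hk : k ∈ cmCompactFactor L ι H T hT)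
    (x : (adelicGroupData (↥(maximalRealSubfield L)) L (IsCMField.complexConj L) 3 H).Adelic) :
    (∫ u, β u * invQuot (adelicGroupData (↥(maximalRealSubfield L)) L (IsCMField.complexConj L) 3 H) F (x * k * cmArchSection L ι H T hT u) ∂ν) = ∫ u, β u * invQuot (adelicGroupData (↥(maximalRealSubfield L)) L (IsCMField.complexConj L) 3 H) F (x * cmArchSection L ι H T hT u) ∂ν := by
  congr 1 with u
  rw [mul_assoc, (commute_cmArchSection_of_mem_cmCompactFactor L ι H T hT hk u).eq, ← mul_assoc,
    ← apply_inv_smul_toAutomorphicQuotient_inv F k, hinvc k⁻¹ (inv_mem hk), invQuot_apply]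

/-- `Θ(x · (1,k)) = Θ(x)` for `k ∈ K_f`. [cite: BorelJacquet1979, §4.1] -/
theorem orbitalIntegral_mul_of_mem_finite (ν : Measure U21) (β : U21 → ℂ) (F : (adelicGroupData (↥(maximalRealSubfield L)) L (IsCMField.complexConj L) 3 H).automorphicQuotient → ℂ)
    {Kf : Subgroup (finAdelic (↥(maximalRealSubfield L)) L (IsCMField.complexConj L) 3 H)}
    (hinvf : ∀ k ∈ Kf, ∀ ξ, F ((finAdelicToAdelic (↥(maximalRealSubfield L)) L (IsCMField.complexConj L) 3 H) k • ξ) = F ξ) {k : finAdelic (↥(maximalRealSubfield L)) L (IsCMField.complexConj L) 3 H}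
    (hk : k ∈ Kf) (x : (adelicGroupData (↥(maximalRealSubfield L)) L (IsCMField.complexConj L) 3 H).Adelic) :
    (∫ u, β u * invQuot (adelicGroupData (↥(maximalRealSubfield L)) L (IsCMField.complexConj L) 3 H) F (x * (finAdelicToAdelic (↥(maximalRealSubfield L)) L (IsCMField.complexConj L) 3 H) k * cmArchSection L ι H T hT u) ∂ν) =
      ∫ u, β u * invQuot (adelicGroupData (↥(maximalRealSubfield L)) L (IsCMField.complexConj L) 3 H) F (x * cmArchSection L ι H T hT u) ∂ν := by
  congr 1 with u
  rw [mul_assoc, (commute_finAdelicToAdelic_cmArchSection L ι H T hT k u).eq, ← mul_assoc,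
    ← apply_inv_smul_toAutomorphicQuotient_inv F ((finAdelicToAdelic (↥(maximalRealSubfield L)) L (IsCMField.complexConj L) 3 H) k), ← map_inv, hinvf k⁻¹ (inv_mem hk), invQuot_apply]

/-- **Orbital integrals of an exactly `K_c K_f`-invariant good function are CONTINUOUS ON `U(H)(𝔸)`** (road (h) step h4): near `x₀`,
`Θ(x) = Θ(x₀ · ιinf(U(x₀⁻¹ x)))` by the decomposition `x₀⁻¹x = ιinf(U) · k · (1, k_f)` with `k_f ∈ K_f` (open condition) and the right
invariances, and `g ↦ Θ(x₀ ιinf(g))` is continuous along the orbit (★ `continuous_orbitalIntegral_mul_hom`).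
[cite: Borel1997, Thm. 2.13 and §8.4] [cite: BorelJacquet1979, §4.1] -/
theorem continuous_orbitalIntegral_of_invariant (ν : Measure U21) [ν.IsHaarMeasure]
    {Kf : Subgroup (finAdelic (↥(maximalRealSubfield L)) L (IsCMField.complexConj L) 3 H)}
    (hKfo : IsOpen (Kf : Set (finAdelic (↥(maximalRealSubfield L)) L (IsCMField.complexConj L) 3 H)))
    {F : (adelicGroupData (↥(maximalRealSubfield L)) L (IsCMField.complexConj L) 3 H).automorphicQuotient → ℂ} (hgood : ∀ x : (adelicGroupData (↥(maximalRealSubfield L)) L (IsCMField.complexConj L) 3 H).Adelic, LocallyIntegrable (fun u : U21 ↦ invQuot (adelicGroupData (↥(maximalRealSubfield L)) L (IsCMField.complexConj L) 3 H) F (x * cmArchSection L ι H T hT u)) ν)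
    (hinvc : ∀ k ∈ cmCompactFactor L ι H T hT, ∀ ξ, F (k • ξ) = F ξ) (hinvf : ∀ k ∈ Kf, ∀ ξ, F ((finAdelicToAdelic (↥(maximalRealSubfield L)) L (IsCMField.complexConj L) 3 H) k • ξ) = F ξ)
    {β : U21 → ℂ} (hβ : Continuous β) (hβs : HasCompactSupport β) :
    Continuous fun x : (adelicGroupData (↥(maximalRealSubfield L)) L (IsCMField.complexConj L) 3 H).Adelic ↦ ∫ u, β u * invQuot (adelicGroupData (↥(maximalRealSubfield L)) L (IsCMField.complexConj L) 3 H) F (x * cmArchSection L ι H T hT u) ∂ν := by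
  set Θ : (adelicGroupData (↥(maximalRealSubfield L)) L (IsCMField.complexConj L) 3 H).Adelic → ℂ := fun x ↦ ∫ u, β u * invQuot (adelicGroupData (↥(maximalRealSubfield L)) L (IsCMField.complexConj L) 3 H) F (x * cmArchSection L ι H T hT u) ∂ν with hΘ
  have hU := continuous_archProjU21EmbCM_archPart L ι H T hT
  refine continuous_iff_continuousAt.2 fun x₀ ↦ ?_
  -- the continuous comparison function
  have hR : Continuous fun x : (adelicGroupData (↥(maximalRealSubfield L)) L (IsCMField.complexConj L) 3 H).Adelic ↦ Θ (x₀ * cmArchSection L ι H T hT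
      (archProjU21EmbCM L H ι T (formCongr_eq_of_conjTranspose L ι H T hT)
        (archPart (↥(maximalRealSubfield L)) L (IsCMField.complexConj L) 3 H (x₀⁻¹ * x)))) :=
    ((adelicGroupData (↥(maximalRealSubfield L)) L (IsCMField.complexConj L) 3 H).continuous_orbitalIntegral_mul_hom ν hβ hβs F (hgood x₀)).comp (hU.comp (continuous_const.mul continuous_id))
  have hV : {x : (adelicGroupData (↥(maximalRealSubfield L)) L (IsCMField.complexConj L) 3 H).Adelic | finPart (↥(maximalRealSubfield L)) L (IsCMField.complexConj L) 3 H (x₀⁻¹ * x) ∈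
      (Kf : Set (finAdelic (↥(maximalRealSubfield L)) L (IsCMField.complexConj L) 3 H))} ∈ 𝓝 x₀ := by
    refine (hKfo.preimage ((continuous_finPart _ _ _ _ _).comp (continuous_const.mul continuous_id))).mem_nhds ?_
    show finPart (↥(maximalRealSubfield L)) L (IsCMField.complexConj L) 3 H (x₀⁻¹ * x₀) ∈ Kf
    rw [inv_mul_cancel, map_one]
    exact Kf.one_mem
  refine hR.continuousAt.congr_of_eventuallyEq ?_
  filter_upwards [hV] with x hx
  obtain ⟨k, hk, hdec⟩ := F0P2aCmFrameFactorisation.exists_eq_cmArchSection_mul_cmCompactFactor_mul_finAdelicToAdelic L ι H T hT (x₀⁻¹ * x)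
  have hx' : x = x₀ * (x₀⁻¹ * x) := by rw [mul_inv_cancel_left]
  show Θ x = Θ _
  conv_lhs => rw [hx', hdec, ← mul_assoc, ← mul_assoc]
  rw [hΘ]
  simp only []
  rw [orbitalIntegral_mul_of_mem_finite L ι H T hT ν β F hinvf hx, orbitalIntegral_mul_of_mem_cmCompactFactor L ι H T hT ν β F hinvc hk]

end Good

end Summit.HodgeConjecture.HodgeConjecture.Cruxes.H413.F0P2dStubR

end
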